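import Summits.AtomisticToContinuum.Crystallization.Theorems.ThreeConeCertificateSlackRigidityPricedFloorsGlobalize2

/-!
# Globalisation of exact local layerings, III: pattern lemmas in one shell

Helper file 3 for the stub `stub_globalize` of the line `priced-floors-palm-exactification`
(crux `ThreeConeCertificate.SlackRigidity`, item 11960).  Finite combinatorics of the first-shell
pattern `shellSet a σ₁ t₁ σ₂ t₂` of an admissible layered set, all reduced to `decide` on integer
codes: the antipodal lemma (an antipodal pair of shell points is in-plane or the shell is
centrally symmetric), the **hexagon completion lemma** (five consecutive vertices of a planar
hexagon through the site force the sixth — the key pattern lemma of Hales's layer induction,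
*Dense Sphere Packings* §1.3, in the distorted patterns of item 13958), the tilted-hexagon lemma
(a hexagonal pair off the layer plane forces the ideal centrally symmetric shell, a regular
cuboctahedron).  The registered sub-goal `globalize_pattern_hexagon` restates the
completion/tilted lemmas in the vocabulary `layeredSet` of the line.
-/

noncomputable section

open Set
open Literature.MathematicalPhysics.StatisticalMechanics
open Summit.AtomisticToContinuum.Crystallization.Theorems.SlackRigidityPricedFloors

namespace Summit.AtomisticToContinuum.Crystallization.Theorems.SlackRigidityPricedFloorsGlobalize

variable {a : ℝ}

/-! ## Pattern lemmas inside one shell -/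

/-- Difference of two coded points. [folklore] -/
theorem coded_sub (a : ℝ) (c c' : ℤ × ℤ) (t t' : ℝ) :
    (lat a c + t • e3) - (lat a c' + t' • e3) = lat a (c - c') + (t - t') • e3 := by
  rw [lat_sub, sub_smul]; abel

section Pattern

variable {σ₁ σ₂ : ℤ} {t₁ t₂ : ℝ}

/-- **Antipodal lemma**: if `v` and `−v` are both first-shell points, then `v` is in-plane, or
the shell is of the centrally symmetric kind (hole triples of opposite types at opposite
heights). [folklore] -/
theorem antipodal (ha : a ≠ 0) (h₁ : σ₁ = 1 ∨ σ₁ = -1) (h₂ : σ₂ = 1 ∨ σ₂ = -1) (ht₁ : t₁ ≠ 0)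
    (ht₂ : t₂ ≠ 0) {v : E3} (hv : v ∈ shellSet a σ₁ t₁ σ₂ t₂)
    (hv' : -v ∈ shellSet a σ₁ t₁ σ₂ t₂) :
    v ∈ shellPart a hexCodes 0 ∨ (σ₂ = -σ₁ ∧ t₂ = -t₁) := by
  obtain ⟨c, t, rfl, hct⟩ := exists_of_mem_shellSet hv
  rw [coded_neg, coded_mem_shellSet_iff ha] at hv'
  rcases hct with ⟨hc, ht⟩ | ⟨hc, ht⟩ | ⟨hc, ht⟩
  · exact Or.inl ((coded_mem_shellPart_iff ha).2 ⟨hc, ht⟩)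
  · right
    rcases hv' with ⟨-, h⟩ | ⟨-, h⟩ | ⟨hc', h⟩
    · exact absurd (by linarith : t₁ = 0) ht₁
    · exact absurd (by linarith : t₁ = 0) ht₁
    · exact ⟨upCodes_antipodal h₁ h₂ hc hc', by linarith⟩
  · right
    rcases hv' with ⟨-, h⟩ | ⟨hc', h⟩ | ⟨-, h⟩
    · exact absurd (by linarith : t₂ = 0) ht₂
    · have := upCodes_antipodal h₂ h₁ hc hc'
      exact ⟨by omega, by linarith⟩
    · exact absurd (by linarith : t₂ = 0) ht₂

/-- **A centrally symmetric shell**: hole triples of opposite types at opposite heights.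
[folklore] -/
theorem neg_mem_shellSet_cs (ha : a ≠ 0) (h₁ : σ₁ = 1 ∨ σ₁ = -1) {v : E3}
    (hv : v ∈ shellSet a σ₁ t₁ (-σ₁) (-t₁)) : -v ∈ shellSet a σ₁ t₁ (-σ₁) (-t₁) := by
  obtain ⟨c, t, rfl, hct⟩ := exists_of_mem_shellSet hv
  rw [coded_neg, coded_mem_shellSet_iff ha]
  rcases hct with ⟨hc, ht⟩ | ⟨hc, ht⟩ | ⟨hc, ht⟩
  · exact Or.inl ⟨neg_mem_hexCodes hc, by rw [ht]; simp⟩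
  · exact Or.inr (Or.inr ⟨neg_mem_upCodes h₁ hc, by rw [ht]⟩)
  · have h₁' : -σ₁ = 1 ∨ -σ₁ = -1 := by omega
    refine Or.inr (Or.inl ⟨?_, by rw [ht]; ring⟩)
    have := neg_mem_upCodes h₁' hc
    rwa [neg_neg] at this

/-- **Hexagon completion** (the key pattern lemma): if five vertices `ξ, ξ − η, −η, −ξ, η − ξ`
of a planar hexagon centred at the base point are first-shell points and `0 < ‖η‖ ≤ 28/25`,
then so is the sixth vertex `η`. [folklore] -/
theorem hex_completion (ha : 47 / 50 ≤ a) (h₁ : σ₁ = 1 ∨ σ₁ = -1) (h₂ : σ₂ = 1 ∨ σ₂ = -1)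
    (ht₁ : t₁ ≠ 0) (ht₂ : t₂ ≠ 0) {η ξ : E3} (hξ : ξ ∈ shellSet a σ₁ t₁ σ₂ t₂)
    (hξ' : -ξ ∈ shellSet a σ₁ t₁ σ₂ t₂) (hd : ξ - η ∈ shellSet a σ₁ t₁ σ₂ t₂)
    (hd' : η - ξ ∈ shellSet a σ₁ t₁ σ₂ t₂) (hη' : -η ∈ shellSet a σ₁ t₁ σ₂ t₂) (hη0 : η ≠ 0)
    (hηn : ‖η‖ ≤ 28 / 25) : η ∈ shellSet a σ₁ t₁ σ₂ t₂ := by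
  have ha0 : a ≠ 0 := by linarith
  rcases antipodal ha0 h₁ h₂ ht₁ ht₂ hξ hξ' with hξh | ⟨rfl, rfl⟩
  swap
  · have := neg_mem_shellSet_cs ha0 h₁ hη'; rwa [neg_neg] at this
  have hd'' : -(ξ - η) ∈ shellSet a σ₁ t₁ σ₂ t₂ := by rwa [neg_sub]
  rcases antipodal ha0 h₁ h₂ ht₁ ht₂ hd hd'' with hdh | ⟨rfl, rfl⟩
  swap
  · have := neg_mem_shellSet_cs ha0 h₁ hη'; rwa [neg_neg] at this
  obtain ⟨c₁, hc₁, e₁⟩ := exists_of_mem_shellPart hξh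
  obtain ⟨c₂, hc₂, e₂⟩ := exists_of_mem_shellPart hdh
  have eη : η = lat a (c₁ - c₂) + (0 : ℝ) • e3 := by
    have : η = ξ - (ξ - η) := by abel
    rw [this, e₂, e₁, coded_sub, sub_zero]
  have hQ : Qf (c₁ - c₂) < 27 := by
    have h1 : ‖η‖ ^ 2 ≤ (28 / 25) ^ 2 := pow_le_pow_left₀ (norm_nonneg _) hηn 2
    rw [eη, norm_coded_sq] at h1
    by_contra hcon
    have : (27 : ℝ) ≤ Qf (c₁ - c₂) := by exact_mod_cast not_lt.1 hcon
    nlinarith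
  rcases hex_sub_hex hc₁ hc₂ hQ with h | h
  · refine absurd ?_ hη0
    rw [eη, h, sub_self, zero_smul, add_zero]
    exact lat_zero a
  · rw [eη, coded_mem_shellSet_iff ha0]
    exact Or.inl ⟨h, rfl⟩

/-- **A tilted hexagonal pair forces the ideal centrally symmetric shell**: if `η, −η, ξ,
η − ξ` are first-shell points with `‖ξ‖ = ‖η‖ = ‖η − ξ‖` and `η` is NOT in-plane, then the shell
is centrally symmetric with the ideal height `t₁² = 2a²/3` (a regular cuboctahedron).
[folklore] -/
theorem csi_of_not_hex (ha : a ≠ 0) (h₁ : σ₁ = 1 ∨ σ₁ = -1) (h₂ : σ₂ = 1 ∨ σ₂ = -1)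
    (ht₁ : t₁ ≠ 0) (ht₂ : t₂ ≠ 0) {η ξ : E3} (hη : η ∈ shellSet a σ₁ t₁ σ₂ t₂)
    (hη' : -η ∈ shellSet a σ₁ t₁ σ₂ t₂) (hξ : ξ ∈ shellSet a σ₁ t₁ σ₂ t₂)
    (hd : η - ξ ∈ shellSet a σ₁ t₁ σ₂ t₂) (hn1 : ‖ξ‖ = ‖η‖) (hn2 : ‖η - ξ‖ = ‖η‖)
    (hnot : η ∉ shellPart a hexCodes 0) :
    σ₂ = -σ₁ ∧ t₂ = -t₁ ∧ t₁ ^ 2 = 2 * a ^ 2 / 3 := by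
  rcases antipodal ha h₁ h₂ ht₁ ht₂ hη hη' with h | ⟨hσ, ht⟩
  · exact absurd h hnot
  refine ⟨hσ, ht, ?_⟩
  obtain ⟨c, t, rfl, hct⟩ := exists_of_mem_shellSet hη
  have htv : (t = t₁ ∨ t = -t₁) ∧ Qf c = 3 := by
    rcases hct with ⟨hc, ht0⟩ | ⟨hc, h⟩ | ⟨hc, h⟩
    · exact absurd ((coded_mem_shellPart_iff ha).2 ⟨hc, ht0⟩) hnot
    · exact ⟨Or.inl h, Qf_of_mem_upCodes h₁ hc⟩
    · exact ⟨Or.inr (by rw [h, ht]), Qf_of_mem_upCodes h₂ hc⟩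
  have ht2 : t ^ 2 = t₁ ^ 2 := by rcases htv.1 with h | h <;> simp [h]
  have hη2 : ‖lat a c + t • e3‖ ^ 2 = a ^ 2 / 3 + t₁ ^ 2 := by
    rw [norm_coded_sq, htv.2, ht2]; push_cast; ring
  obtain ⟨c', t', rfl, hct'⟩ := exists_of_mem_shellSet hξ
  have e1 : ‖lat a c' + t' • e3‖ ^ 2 = ‖lat a c + t • e3‖ ^ 2 := by rw [hn1]
  rcases hct' with ⟨hc', ht'⟩ | hrest
  · rw [norm_coded_sq, Qf_of_mem_hexCodes hc', ht', hη2] at e1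
    push_cast at e1
    linarith
  · have ht'v : t' = t₁ ∨ t' = -t₁ := by
      rcases hrest with ⟨-, h⟩ | ⟨-, h⟩
      · exact Or.inl h
      · exact Or.inr (by rw [h, ht])
    rw [coded_sub, coded_mem_shellSet_iff ha] at hd
    have hcc : c - c' ∈ hexCodes ∧ t - t' = 0 := by
      rcases hd with h | ⟨-, h⟩ | ⟨-, h⟩
      · exact h
      · exfalso
        rcases htv.1 with h0 | h0 <;> rcases ht'v with h0' | h0' <;> rw [h0, h0'] at h <;>
          exact ht₁ (by linarith)
      · exfalso
        rw [ht] at h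
        rcases htv.1 with h0 | h0 <;> rcases ht'v with h0' | h0' <;> rw [h0, h0'] at h <;>
          exact ht₁ (by linarith)
    have e2 : ‖lat a c + t • e3 - (lat a c' + t' • e3)‖ ^ 2 = ‖lat a c + t • e3‖ ^ 2 := by rw [hn2]
    rw [coded_sub, norm_coded_sq, Qf_of_mem_hexCodes hcc.1, hcc.2, hη2] at e2
    push_cast at e2
    linarith

/-- **Regular-cuboctahedron shells**: a shell pattern that is centrally symmetric as a set and
all of whose points have the same norm is of the ideal centrally symmetric kind. [folklore] -/
theorem csi_of_symm_of_norms (ha : a ≠ 0) (h₁ : σ₁ = 1 ∨ σ₁ = -1) (h₂ : σ₂ = 1 ∨ σ₂ = -1)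
    (ht₁ : t₁ ≠ 0) (ht₂ : t₂ ≠ 0)
    (hsym : ∀ v ∈ shellSet a σ₁ t₁ σ₂ t₂, -v ∈ shellSet a σ₁ t₁ σ₂ t₂)
    (hno : ∀ v ∈ shellSet a σ₁ t₁ σ₂ t₂, ∀ w ∈ shellSet a σ₁ t₁ σ₂ t₂, ‖v‖ = ‖w‖) :
    σ₂ = -σ₁ ∧ t₂ = -t₁ ∧ t₁ ^ 2 = 2 * a ^ 2 / 3 := by
  have hv : lat a (σ₁, σ₁) + t₁ • e3 ∈ shellSet a σ₁ t₁ σ₂ t₂ :=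
    (coded_mem_shellSet_iff ha).2 (Or.inr (Or.inl ⟨diag_mem_upCodes σ₁, rfl⟩))
  rcases antipodal ha h₁ h₂ ht₁ ht₂ hv (hsym _ hv) with h | ⟨hσ, ht⟩
  · exact absurd ((coded_mem_shellPart_iff ha).1 h).2 ht₁
  refine ⟨hσ, ht, ?_⟩
  have hw : lat a (3, 0) ∈ shellSet a σ₁ t₁ σ₂ t₂ := lat_mem_shellSet mem_hexCodes_basic.1
  have e := hno _ hv _ hw
  have e2 : ‖lat a (σ₁, σ₁) + t₁ • e3‖ ^ 2 = ‖lat a (3, 0)‖ ^ 2 := by rw [e]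
  rw [norm_coded_sq, norm_lat_sq, Qf_of_mem_upCodes h₁ (diag_mem_upCodes σ₁),
    Qf_of_mem_hexCodes mem_hexCodes_basic.1] at e2
  push_cast at e2
  linarith

/-- In an ideal centrally symmetric shell all points have norm `a`. [folklore] -/
theorem norm_sq_of_csi (ha : 0 < a) (h₁ : σ₁ = 1 ∨ σ₁ = -1) (hid : t₁ ^ 2 = 2 * a ^ 2 / 3)
    {v : E3} (hv : v ∈ shellSet a σ₁ t₁ (-σ₁) (-t₁)) : ‖v‖ = a := by
  have h₁' : -σ₁ = 1 ∨ -σ₁ = -1 := by omega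
  have hsq : ‖v‖ ^ 2 = a ^ 2 := by
    obtain ⟨c, t, rfl, ⟨hc, ht⟩ | ⟨hc, ht⟩ | ⟨hc, ht⟩⟩ := exists_of_mem_shellSet hv <;>
      rw [norm_coded_sq, ht]
    · rw [Qf_of_mem_hexCodes hc]; push_cast; ring
    · rw [Qf_of_mem_upCodes h₁ hc]; push_cast; linarith
    · rw [Qf_of_mem_upCodes h₁' hc]; push_cast; nlinarith
  exact (pow_left_inj₀ (norm_nonneg v) ha.le two_ne_zero).1 hsq

end Pattern

/-- `e₃` is orthogonal to the lateral vectors. [folklore] -/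
theorem inner_e3_lat (a : ℝ) (c : ℤ × ℤ) : inner ℝ e3 (lat a c) = 0 := by
  rw [Literature.Geometry.DiscreteGeometry.inner_fin3]; simp [e3, lat]


/-! ## The key pattern lemma in the vocabulary of the line -/

/-- **The key pattern lemma (registered sub-goal `globalize_pattern_hexagon`).** In an
admissible layered set through `0` (`z 0 = 0`): if the five consecutive vertices
`ξ, ξ − η, −η, −ξ, η − ξ` of a regular planar hexagon `{±η, ±ξ, ±(η − ξ)}` centred at `0` (side
`‖η‖ = ‖ξ‖ = ‖η − ξ‖ ∈ (0, 28/25]`) are pattern points, then so is the sixth vertex `η`; and if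
moreover `η` is not in the layer plane through `0`, the site `0` is an ideal `c`-type site: the
letters of the layers `−1, 0, 1` are pairwise distinct (`s (−1) = s 0`), both adjacent spacings
are `a√(2/3)` (`z (−1) = −z 1`, `(z 1)² = 2a²/3`), and the side of the hexagon is `a` (so the
twelve neighbours form an exact cuboctahedron). [cite: HalesDSP2012, §1.3] -/
theorem globalize_pattern_hexagon : ∀ (A : E3 →ₗᵢ[ℝ] E3) (a : ℝ) (s : ℤ → ℤ) (z : ℤ → ℝ), IsAdmissibleLayering a s z → z 0 = 0 → ∀ (η ξ : E3), ‖ξ‖ = ‖η‖ → ‖η - ξ‖ = ‖η‖ → 0 < ‖η‖ → ‖η‖ ≤ 28 / 25 → ξ ∈ layeredSet A a s z → -ξ ∈ layeredSet A a s z → ξ - η ∈ layeredSet A a s z → η - ξ ∈ layeredSet A a s z → -η ∈ layeredSet A a s z → η ∈ layeredSet A a s z ∧ (inner ℝ (A (layerNormal 1)) η ≠ 0 → s (-1) = s 0 ∧ z (-1) = -z 1 ∧ z 1 ^ 2 = 2 * a ^ 2 / 3 ∧ ‖η‖ = a) := by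
  intro A₀ a s z hadm hz0 η ξ hn1 hn2 hpos hle hξ hξ' hd hd' hη'
  set A : E3 ≃ₗᵢ[ℝ] E3 := A₀.toLinearIsometryEquiv rfl with hA
  have hcoe : (A : E3 → E3) = A₀ := LinearIsometry.coe_toLinearIsometryEquiv A₀ rfl
  have hL : layeredSet A₀ a s z = A '' stdL a s z := by rw [layeredSet_eq_image, ← hcoe]
  have ha1 := hadm.1
  have ha0 : a ≠ 0 := by linarith
  have hs := hadm.2.2.1
  obtain ⟨-, -, hzp, hzn⟩ := abs_heights_of_adm hadm hz0
  have hσ₁ : s 0 = 1 ∨ s 0 = -1 := hs 0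
  have hσ₂ : -s (-1) = 1 ∨ -s (-1) = -1 := by rcases hs (-1) with h | h <;> omega
  set N := shellSet a (s 0) (z 1) (-s (-1)) (z (-1)) with hNdef
  have toN : ∀ x, x ∈ layeredSet A₀ a s z → ‖x‖ = ‖η‖ → A.symm x ∈ N := by
    intro x hx hxn
    rw [hL] at hx
    obtain ⟨p, hp, rfl⟩ := hx
    rw [A.symm_apply_apply]
    rw [A.norm_map] at hxn
    refine mem_shellSet_of_norm_le hadm hz0 hp ?_ (by linarith)
    rintro rfl
    rw [norm_zero] at hxn
    linarith
  have k1 : A.symm ξ ∈ N := toN ξ hξ hn1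
  have k2 : -A.symm ξ ∈ N := by rw [← map_neg]; exact toN _ hξ' (by rw [norm_neg, hn1])
  have k3 : A.symm ξ - A.symm η ∈ N := by
    rw [← map_sub]; exact toN _ hd (by rw [← norm_neg, neg_sub, hn2])
  have k4 : A.symm η - A.symm ξ ∈ N := by rw [← map_sub]; exact toN _ hd' hn2
  have k5 : -A.symm η ∈ N := by rw [← map_neg]; exact toN _ hη' (norm_neg _)
  have hη0 : A.symm η ≠ 0 := by
    intro h
    rw [← A.symm.norm_map, h, norm_zero] at hpos
    exact lt_irrefl _ hpos
  have hηn : ‖A.symm η‖ ≤ 28 / 25 := by rwa [A.symm.norm_map]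
  have hηN : A.symm η ∈ N := hex_completion ha1 hσ₁ hσ₂ hzp.ne' hzn.ne k1 k2 k3 k4 k5 hη0 hηn
  refine ⟨?_, fun hinner => ?_⟩
  · rw [hL]
    exact ⟨A.symm η, shellSet_subset_stdL hs hz0 hηN, A.apply_symm_apply η⟩
  · have hnot : A.symm η ∉ shellPart a hexCodes 0 := by
      intro hmem
      obtain ⟨c, -, hc⟩ := exists_of_mem_shellPart hmem
      apply hinner
      rw [zero_smul, add_zero] at hc
      have e1 : η = A (lat a c) := by rw [← hc, A.apply_symm_apply]
      have e2 : A₀ (layerNormal 1) = A e3 := by rw [layerNormal_one, ← hcoe]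
      rw [e1, e2, A.inner_map_map]
      exact inner_e3_lat a c
    have hn1' : ‖A.symm ξ‖ = ‖A.symm η‖ := by rw [A.symm.norm_map, A.symm.norm_map, hn1]
    have hn2' : ‖A.symm η - A.symm ξ‖ = ‖A.symm η‖ := by
      rw [← map_sub, A.symm.norm_map, A.symm.norm_map, hn2]
    obtain ⟨hcs1, hcs2, hid⟩ :=
      csi_of_not_hex ha0 hσ₁ hσ₂ hzp.ne' hzn.ne hηN k5 k1 k4 hn1' hn2' hnot
    refine ⟨by omega, hcs2, hid, ?_⟩
    rw [hNdef, hcs1, hcs2] at hηN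
    rw [← A.symm.norm_map]
    exact norm_sq_of_csi (by linarith) hσ₁ hid hηN

end Summit.AtomisticToContinuum.Crystallization.Theorems.SlackRigidityPricedFloorsGlobalize

end
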